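import Summits.Parity.GeneralizedHardyLittlewood.Theses.ZDegreeToeplitzBand

/-!
# Route `ZDegreeToeplitzBand` — the Assembly item (stmt-Parity-20017), closed

`Assembly := InClassSideTables → PsiGradedTables → PsiGradedTablesClose → Zhang2022.Skeleton.Theorem1`
is, verbatim, the type of the route's deciding theorem `closes` with its three hypotheses curried
(K0 side tables, K1 the three ψ-graded tables, K2 the sign), so the item is pure logic: no crux is
touched and no printed fact is a binder. The chain inside `closes` (route file, rev 0): either (A)
fails for all large `D` — then Theorem 1 is the tree's
`Skeleton.theorem1_of_eventually_not_assumptionA` — or (A)-characters recur, and K1 + K2 assemble the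
packaged crux `KnifeEdge.GradedClosesPsi c′` for all large `c′`, which with K0 gives Theorem 1 by
`KnifeEdge.theorem1_of_gradedClosesPsi_pack_eventually` (p485893). Candidate term of record: refuter
pre-read ls-ref-1 g4 (evidence `AssemblyProofZ.lean` ce7c21e8e9f44c6e, memo ZDEG-PREREAD.md
8c2bfe02a8ba72ce), landed here under the `Theorems` naming convention. Cell landau-siegel §D,
ls-knife-typer-3 g8. Standard axioms only.

«The programme SEARCHES and TYPES; no claim about Landau–Siegel zeros, Theorems 1–2 of
arXiv:2211.02515 or a repaired Margin232 until a kernel theorem says so.»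
-/

namespace Summit.Parity.GeneralizedHardyLittlewood.Theorems

/-- **`Assembly` of route `ZDegreeToeplitzBand`** (stmt-Parity-20017):
`InClassSideTables → PsiGradedTables → PsiGradedTablesClose → Zhang2022.Skeleton.Theorem1` holds — it
is the route's deciding theorem `ZDegreeToeplitzBand.closes` with its three hypotheses curried
(`fun h0 h1 h2 => closes h0 h1 h2`). [cite: Zhang2022LandauSiegel, §2 (2.16)–(2.17)] -/
theorem zDegreeToeplitzBandAssembly_proof :
    Summit.Parity.GeneralizedHardyLittlewood.Theses.ZDegreeToeplitzBand.Assembly := by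
  unfold Summit.Parity.GeneralizedHardyLittlewood.Theses.ZDegreeToeplitzBand.Assembly
  intro h0 h1 h2
  -- buildfix (bf3-g27, 2026-08-27): the route's `closes` was re-keyed (rev 14:15Z 08-27) to the repaired
  -- K0 item `InClassSideTablesPiece`; this CLOSED item keeps its accepted statement over the original
  -- `InClassSideTables`, so the rev-0 chain of `closes` is inlined here through the still-landed glue
  -- `KnifeEdge.theorem1_of_gradedClosesPsi_pack_eventually` (p485893). Statement byte-identical.
  by_cases hA : Literature.NumberTheory.LFunctions.Zhang2022.Skeleton.ForAllLarge
      (fun D _ χ => ¬ Literature.NumberTheory.LFunctions.Zhang2022.Skeleton.AssumptionA D χ)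
  · exact Literature.NumberTheory.LFunctions.Zhang2022.Skeleton.theorem1_of_eventually_not_assumptionA hA
  · obtain ⟨c₁, hK1⟩ := h1
    obtain ⟨c₂, hK2⟩ := h2 hA
    refine Literature.NumberTheory.LFunctions.Zhang2022.KnifeEdge.theorem1_of_gradedClosesPsi_pack_eventually h0
      ⟨max c₁ c₂, fun c' hc' => ?_⟩
    obtain ⟨X₁, Y₁, X₂, t1, t21, t2⟩ := hK1 c' (le_trans (le_max_left _ _) hc')
    exact ⟨X₁, Y₁, X₂, t1, t21, t2, hK2 c' (le_trans (le_max_right _ _) hc') X₁ Y₁ X₂ t1 t21 t2⟩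

end Summit.Parity.GeneralizedHardyLittlewood.Theorems
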